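import Literature.NumberTheory.GaloisRepresentations.GaloisCohomology
import Literature.NumberTheory.GaloisRepresentations.SemiLocalUnitGroupShapiro
import Literature.NumberTheory.GaloisRepresentations.RestrictedRamification
import Mathlib.RingTheory.DedekindDomain.SInteger
import HarnessLib

/-!
# The `S`-units as Galois modules: `𝒪_{E,S}ˣ` at a finite layer and `E_S = 𝒪_{K_S,S}ˣ` over the
# maximal extension unramified outside `S` (Neukirch–Schmidt–Wingberg VIII §3; Harari §17.4)

Topic `NumberTheory/GaloisRepresentations`; namespace
`Literature.NumberTheory.GaloisRepresentations.SUnits`.  DEFINITIONS WITH BODIES (no named fact, no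
`sorry`, no instance, no notation) and their unfolding lemmas / first API.

Neukirch–Schmidt–Wingberg, *Cohomology of Number Fields* VIII §3 (before (8.3.1)): for a number field
`k`, a set `S` of primes and an extension `K|k` inside `k_S`, "`𝒪_{K,S}`" (the `S`-integers: elements
integral at all primes not above `S`) and "`E_{K,S} = 𝒪_{K,S}^×`" (the `S`-units), and for
`K = k_S`: "`E_S = 𝒪_{k_S,S}^× = lim→ 𝒪_{K,S}^×`"; Harari, *Galois Cohomology and Class Field Theory*
§17.4 (p. 296): "Let `E_{F,S} := 𝒪_{F,S}^*` … We denote by … `E_S` that [inductive limit] of the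
`E_{F,S}`", Lemma 17.21 (a) (`E_S` is `ℓ`-divisible for `ℓ ∈ 𝒪_{k,S}^*`).

## Design

For a number field `K`, a set `S` of finite places of `K` (`HeightOneSpectrum (𝓞 K)`) and ANY field
`L` with `Algebra K L`, an element `x ∈ Lˣ` is an **`S`-unit (over `K`)** iff `x` and `x⁻¹` are
INTEGRAL over the ring of `S`-integers `𝒪_{K,S} = S.integer K` (Mathlib `Set.integer`).  This is
field-choice-free (it needs no places of `L`), manifestly stable under every `K`-algebra map, and
agrees — for `L = E` a finite extension, the integral closure of `𝒪_{K,S}` in `E` being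
`𝒪_{E,S_E}` — with "`w(x) = 0` at every finite place `w` of `E` not above `S`" (the valuation
characterisation is a THEOREM of the sequel proofs file, not part of the definition).

* §1 `sUnits K S L : Subgroup Lˣ` and its API (`mem_sUnits_iff`, stability under `K`-algebra
  homomorphisms and automorphisms, transport along injective algebra maps, roots of unity).
* §2 finite layers: for a tower `K → F → E` of fields, `sUnitsRep K S F E : Rep ℤ (E ≃ₐ[F] E)`, the
  `Gal(E/F)`-module `𝒪_{E,S}ˣ` (additively; tree `Herbrand.stableRepr`), with its unfolding lemma.
* §3 the level `K̄`: `sUnitsSubmodule K S ≤ UnitsCarrier K` (the `S`-units of `K̄` inside the tree's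
  discrete `Γ_K`-module `K̄ˣ = DiscreteGaloisModule.units K`), the discrete `Γ_K`-module
  `sUnitsModule K S` (a `ContinuousRep.subrepresentation` of `units K`), and
  **`sUnitsRestricted K S`** = `E_S := (𝒪_{K̄,S}ˣ)^{N_S} = 𝒪_{K_S,S}ˣ` as a continuous module over
  `G_{K,S} = Γ_K ⧸ N_S` (`quotientInvariants`, exactly the pattern of the tree's
  `restrictedCohomology`): THE module of NSW's proof of (8.3.18) (`cd_ℓ(G_S) ≤ 2` from the Kummer
  sequence `0 → μ_ℓ → E_S → E_S → 0` and (8.3.11)).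

Written for lane «PT3-TC» of cell `bsd-eis` (crux `GoodLatticeBDPValue`, stmt-BirchSwinnertonDyer-19032;
road memo `PT3TC-ROAD.md`, brick (A1)): the sequel files prove `E_S[p] = μ_p`, `p·E_S = E_S` for
`S ⊇ S_p`, the valuation characterisation, and compute `H²`, `H³` through the finite layers.

## References
* J. Neukirch, A. Schmidt, K. Wingberg, *Cohomology of Number Fields*, 2nd ed. (2008), VIII §3
  (`𝒪_{K,S}`, `E_{K,S}`, `E_S`), (8.3.11), (8.3.18). [NeukirchSchmidtWingberg2008]
* D. Harari, *Galois Cohomology and Class Field Theory* (2020), §17.4 (p. 296), Lemma 17.21 (a).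
  [Harari2020]
* J. Neukirch, *Algebraic Number Theory* (1999), Ch. I §11 (`S`-integers), Ch. VI §1. [NeukirchANT1999]
-/

noncomputable section

open NumberField IsDedekindDomain Field

namespace Literature.NumberTheory.GaloisRepresentations.SUnits

variable (K : Type) [Field K] [NumberField K] (S : Set (HeightOneSpectrum (𝓞 K)))

/-! ### §1. `S`-units over `K` in a `K`-algebra -/

/-- **The `S`-units of `L` over `K`**: the units `x ∈ Lˣ` of a field `L ⊇ K` such that `x` and `x⁻¹`
are integral over the `S`-integers `𝒪_{K,S} = S.integer K` of `K` ("`E_{L,S} = 𝒪_{L,S}^×`", the units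
of the integral closure of `𝒪_{K,S}` in `L`; for `L = K̄` or `L = K_S` the union of the `𝒪_{E,S}^×`
over the finite subextensions `E`).
[cite: NeukirchSchmidtWingberg2008, VIII §3 (notation `𝒪_{K,S}`, `E_{K,S}`, `E_S`)]
[cite: Harari2020, §17.4 (p. 296)] -/
def sUnits (L : Type) [Field L] [Algebra K L] : Subgroup Lˣ where
  carrier := {x | IsIntegral (S.integer K) (x : L) ∧ IsIntegral (S.integer K) (↑x⁻¹ : L)}
  one_mem' := ⟨by rw [Units.val_one]; exact isIntegral_one,
    by rw [inv_one, Units.val_one]; exact isIntegral_one⟩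
  mul_mem' := fun {x y} hx hy =>
    ⟨by rw [Units.val_mul]; exact hx.1.mul hy.1,
      by rw [mul_inv_rev, Units.val_mul]; exact hy.2.mul hx.2⟩
  inv_mem' := fun {x} hx => ⟨hx.2, by rw [inv_inv]; exact hx.1⟩

variable {K S}
variable {L : Type} [Field L] [Algebra K L]

/-- Membership in `sUnits K S L`: `x` and `x⁻¹` are integral over `𝒪_{K,S}`.
[cite: NeukirchSchmidtWingberg2008, VIII §3] -/
theorem mem_sUnits_iff (x : Lˣ) :
    x ∈ sUnits K S L ↔ IsIntegral (S.integer K) (x : L) ∧ IsIntegral (S.integer K) (↑x⁻¹ : L) :=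
  Iff.rfl

/-- **`S`-units are preserved by `K`-algebra homomorphisms** (integrality over `𝒪_{K,S} ⊆ K` is).
[cite: NeukirchSchmidtWingberg2008, VIII §3] -/
theorem map_mem_sUnits {L' : Type} [Field L'] [Algebra K L'] (f : L →ₐ[K] L') {x : Lˣ}
    (hx : x ∈ sUnits K S L) : Units.map (f : L →* L') x ∈ sUnits K S L' := by
  refine ⟨?_, ?_⟩
  · simpa [Units.coe_map] using hx.1.map (f.restrictScalars (S.integer K))
  · simpa [Units.coe_map_inv] using hx.2.map (f.restrictScalars (S.integer K))

/-- **`S`-units are REFLECTED by injective `K`-algebra homomorphisms** (so are integral elements,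
Mathlib `isIntegral_algHom_iff`): for a tower `K → L → L'`, `x ∈ Lˣ` is an `S`-unit iff its image
in `L'` is. [cite: NeukirchSchmidtWingberg2008, VIII §3] -/
theorem map_mem_sUnits_iff {L' : Type} [Field L'] [Algebra K L'] (f : L →ₐ[K] L') (x : Lˣ) :
    Units.map (f : L →* L') x ∈ sUnits K S L' ↔ x ∈ sUnits K S L := by
  have hf : Function.Injective (f.restrictScalars (S.integer K)) := f.toRingHom.injective
  refine ⟨fun h => ⟨?_, ?_⟩, map_mem_sUnits f⟩
  · have h1 : IsIntegral (S.integer K) (f.restrictScalars (S.integer K) (x : L)) := by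
      simpa [Units.coe_map] using h.1
    exact (isIntegral_algHom_iff (f.restrictScalars (S.integer K)) hf).1 h1
  · have h2 : IsIntegral (S.integer K) (f.restrictScalars (S.integer K) (↑x⁻¹ : L)) := by
      simpa [Units.coe_map_inv] using h.2
    exact (isIntegral_algHom_iff (f.restrictScalars (S.integer K)) hf).1 h2

/-- **`S`-units are stable under `K`-algebra automorphisms** (the Galois action `σ • x`,
Mathlib's `MulDistribMulAction (L ≃ₐ[K] L) Lˣ`). [cite: NeukirchSchmidtWingberg2008, VIII §3] -/
theorem smul_mem_sUnits (σ : L ≃ₐ[K] L) {x : Lˣ} (hx : x ∈ sUnits K S L) : σ • x ∈ sUnits K S L := by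
  have h := map_mem_sUnits (σ : L →ₐ[K] L) hx
  have e : Units.map ((σ : L →ₐ[K] L) : L →* L) x = σ • x := Units.ext rfl
  rwa [e] at h

/-- **Roots of unity are `S`-units** (they and their inverses are integral over `ℤ ⊆ 𝒪_{K,S}`); in
particular `μ_p ⊆ E_S`. [cite: NeukirchSchmidtWingberg2008, VIII §3 (proof of (8.3.18): `μ_p ⊂ 𝒪_S^×`)] -/
theorem mem_sUnits_of_pow_eq_one {x : Lˣ} {n : ℕ} (hn : 0 < n) (hx : x ^ n = 1) :
    x ∈ sUnits K S L := by
  have key : ∀ y : Lˣ, y ^ n = 1 → IsIntegral (S.integer K) (y : L) := fun y hy =>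
    ⟨Polynomial.X ^ n - 1, Polynomial.monic_X_pow_sub_C (1 : S.integer K) hn.ne', by
      simp only [Polynomial.eval₂_sub, Polynomial.eval₂_X_pow, Polynomial.eval₂_one]
      rw [← Units.val_pow_eq_pow_val, hy, Units.val_one, sub_self]⟩
  exact ⟨key x hx, key x⁻¹ (by rw [inv_pow, hx, inv_one])⟩

/-! ### §2. Finite layers: `𝒪_{E,S}ˣ` as a `Gal(E/F)`-module -/

section Layer

variable (K S)
variable (F E : Type) [Field F] [Field E] [Algebra K F] [Algebra K E] [Algebra F E]
  [IsScalarTower K F E]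

/-- The action of `Gal(E/F)` on `Eˣ` through `K`-algebra automorphisms, as a homomorphism to
`MulAut Eˣ` (plumbing for `sUnitsRep`). [folklore] -/
def galUnitsAut : (E ≃ₐ[F] E) →* MulAut Eˣ :=
  MulDistribMulAction.toMulAut (E ≃ₐ[F] E) Eˣ

/-- `galUnitsAut σ x = σ • x` (the Galois action on the units of the layer).
[cite: NeukirchSchmidtWingberg2008, VIII §3] -/
@[simp] theorem galUnitsAut_apply (σ : E ≃ₐ[F] E) (x : Eˣ) : galUnitsAut F E σ x = σ • x := rfl

/-- `Gal(E/F)` preserves the `S`-units of `E` over `K` (`K ⊆ F ⊆ E`): an `F`-automorphism is a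
`K`-automorphism. [cite: NeukirchSchmidtWingberg2008, VIII §3] -/
theorem galUnitsAut_mem (σ : E ≃ₐ[F] E) (x : Eˣ) (hx : x ∈ sUnits K S E) :
    galUnitsAut F E σ x ∈ sUnits K S E := by
  rw [galUnitsAut_apply]
  have e : σ • x = σ.restrictScalars K • x := Units.ext rfl
  rw [e]
  exact smul_mem_sUnits (σ.restrictScalars K) hx

/-- **The `Gal(E/F)`-module `𝒪_{E,S}ˣ` of `S`-units of `E` over `K`** (`K ⊆ F ⊆ E`), additively, as an
object of `Rep ℤ Gal(E/F)` (tree `Herbrand.stableRepr`: a stable subgroup as a representation) — the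
finite-layer module `E_{E,S}` of NSW VIII §3 / Harari §17.4, whose cohomology in degrees `2, 3`
computes `Hʳ(G_S, E_S)` in the limit. [cite: NeukirchSchmidtWingberg2008, VIII §3 (E_{K,S}), (8.3.11)]
[cite: Harari2020, §17.4 (p. 296)] -/
def sUnitsRep : Rep ℤ (E ≃ₐ[F] E) :=
  Rep.of (Herbrand.stableRepr (galUnitsAut F E) (sUnits K S E) (galUnitsAut_mem K S F E))

/-- The action of `sUnitsRep` on underlying units is the Galois action `σ • x`.
[cite: NeukirchSchmidtWingberg2008, VIII §3] -/
theorem coe_toMul_sUnitsRep_ρ (σ : E ≃ₐ[F] E) (x : Additive (sUnits K S E)) :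
    ((Additive.toMul ((sUnitsRep K S F E).ρ σ x) : sUnits K S E) : Eˣ) =
      σ • ((Additive.toMul x : sUnits K S E) : Eˣ) := rfl

end Layer

/-! ### §3. The level `K̄`: `𝒪_{K̄,S}ˣ ≤ K̄ˣ` as a discrete `Γ_K`-module and `E_S = 𝒪_{K_S,S}ˣ` over `G_{K,S}` -/

section Bar

variable (K S)

open DiscreteGaloisModule

/-- **The `S`-units of `K̄` inside the tree's discrete `Γ_K`-module `K̄ˣ`** (`UnitsCarrier K =
Additive K̄ˣ`, `DiscreteGaloisModule.units K`), as a `ℤ`-submodule.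
[cite: NeukirchSchmidtWingberg2008, VIII §3] [cite: Harari2020, §17.4 (p. 296)] -/
def sUnitsSubmodule : Submodule ℤ (UnitsCarrier K) :=
  AddSubgroup.toIntSubmodule
    { carrier := {u | (UnitsCarrier.toAdditive u).toMul ∈ sUnits K S (AlgebraicClosure K)}
      zero_mem' := (sUnits K S (AlgebraicClosure K)).one_mem
      add_mem' := fun hu hv => (sUnits K S (AlgebraicClosure K)).mul_mem hu hv
      neg_mem' := fun hu => (sUnits K S (AlgebraicClosure K)).inv_mem hu }

/-- Membership in `sUnitsSubmodule K S`. [cite: NeukirchSchmidtWingberg2008, VIII §3] -/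
theorem mem_sUnitsSubmodule_iff (u : UnitsCarrier K) :
    u ∈ sUnitsSubmodule K S ↔ (UnitsCarrier.toAdditive u).toMul ∈ sUnits K S (AlgebraicClosure K) :=
  Iff.rfl

/-- `sUnitsSubmodule K S` is `Γ_K`-stable in `K̄ˣ`. [cite: NeukirchSchmidtWingberg2008, VIII §3] -/
theorem sUnitsSubmodule_le_comap (σ : absoluteGaloisGroup K) :
    sUnitsSubmodule K S ≤ (sUnitsSubmodule K S).comap (units K σ) := fun u hu => by
  rw [Submodule.mem_comap, mem_sUnitsSubmodule_iff]
  have h : (UnitsCarrier.toAdditive (units K σ u)).toMul = σ • (UnitsCarrier.toAdditive u).toMul := by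
    rw [units_apply_apply]; rfl
  have e : σ • (UnitsCarrier.toAdditive u).toMul =
      absoluteGaloisGroup.toAlgEquiv K σ • (UnitsCarrier.toAdditive u).toMul :=
    Units.ext (by rw [Units.coe_smul]; rfl)
  rw [h, e]
  exact smul_mem_sUnits (absoluteGaloisGroup.toAlgEquiv K σ) hu

/-- **The discrete `Γ_K`-module `𝒪_{K̄,S}ˣ`** of `S`-units of `K̄` (continuous subrepresentation of
`K̄ˣ` on `sUnitsSubmodule K S`; discrete subspace topology).
[cite: NeukirchSchmidtWingberg2008, VIII §3] [cite: Harari2020, §17.4 (p. 296)] -/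
def sUnitsModule : DiscreteGaloisModule K (sUnitsSubmodule K S) :=
  (units K).subrepresentation (sUnitsSubmodule K S) (sUnitsSubmodule_le_comap K S)

/-- The action of `sUnitsModule` on underlying elements of `K̄ˣ` is that of `units K`.
[cite: NeukirchSchmidtWingberg2008, VIII §3] -/
@[simp] theorem sUnitsModule_apply_coe (σ : absoluteGaloisGroup K) (u : sUnitsSubmodule K S) :
    ((sUnitsModule K S σ u : sUnitsSubmodule K S) : UnitsCarrier K) = units K σ u := rfl

/-- **`E_S = 𝒪_{K_S,S}ˣ` as a continuous `G_{K,S}`-module**: the `N_S`-invariants of the `S`-units of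
`K̄` (`N_S = ramificationSubgroup K S`, `K_S = K̄^{N_S}`), a discrete module over
`G_{K,S} = Γ_K ⧸ N_S = GaloisGroupUnramifiedOutside K S` (the tree's `quotientInvariants`, as in
`restrictedCohomology`).  Its continuous cohomology restricted to an open `U = Gal(K_S/K′) ≤ G_{K,S}` is
`Hʳ(G_S(K′), E_S)` of NSW (8.3.11). [cite: NeukirchSchmidtWingberg2008, VIII §3 (E_S = 𝒪_{k_S,S}^×), (8.3.11), (8.3.18)]
[cite: Harari2020, §17.4 (p. 296), Lemma 17.21 (a)] -/
def sUnitsRestricted :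
    ContinuousRep (GaloisGroupUnramifiedOutside K S) ℤ
      (Representation.invariants
        ((sUnitsModule K S).toRepresentation.comp (ramificationSubgroup K S).subtype)) :=
  (sUnitsModule K S).quotientInvariants (ramificationSubgroup K S)

/-- Unfolding lemma for `sUnitsRestricted` on classes of elements of `Γ_K`.
[cite: NeukirchSchmidtWingberg2008, VIII §3] -/
@[simp] theorem sUnitsRestricted_apply_coe (σ : absoluteGaloisGroup K)
    (w : Representation.invariants
      ((sUnitsModule K S).toRepresentation.comp (ramificationSubgroup K S).subtype)) :
    ((sUnitsRestricted K S (σ : GaloisGroupUnramifiedOutside K S) w :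
        Representation.invariants
          ((sUnitsModule K S).toRepresentation.comp (ramificationSubgroup K S).subtype)) :
      sUnitsSubmodule K S) = sUnitsModule K S σ w := rfl

end Bar

end Literature.NumberTheory.GaloisRepresentations.SUnits

end
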